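import Literature.MathematicalPhysics.QuantumFieldTheory.CurvatureGaussianField
import HarnessLib

/-!
# Gaussian fields of a kernel: letters (sum form of positivity, re-indexing, Mathlib `IsGaussian`, covariance kernels)

Theorem-only file (no definitions, no named facts) over the tree's centred Gaussian fields `gaussianFieldOfKernel K` on `ι → ℝ`
(`Literature.MathematicalPhysics.QuantumFieldTheory`, `CurvatureGaussianField.lean`; Kallenberg 2002 Lemma 13.1).  Generic letters used by
`GaussianFieldCouplingPositivity.lean` ∕ `GaussianFieldReflectionPositivity.lean` (reflection positivity of Gaussian lattice fields):

* `isPosSemidefKernel_symm`, ★ `isPosSemidefKernel_sum_sum_nonneg` (the SUM FORM of positive semidefiniteness along arbitrary finite families,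
  repetitions allowed — group coefficients along the fibres), `isPosSemidefKernel_of_sum_sum_nonneg` (converse), `isPosSemidefKernel_precomp`;
* ★ `gaussianFieldOfKernel_map_precomp` — push-forward under ANY re-indexing of sites `g : J → V`: `N(0,K).map (σ ↦ σ ∘ g) = N(0, K ∘ (g × g))`
  (uniqueness of the Gaussian field of a kernel);
* `isGaussian_gaussianFieldOfKernel` — over a finite index type the Gaussian field is an `IsGaussian` measure on the Banach space `W → ℝ`;
  `isGaussianProcess_apply_of_hasGaussianLaw` — the coordinates of a Gaussian random vector in `J → ℝ` form a Gaussian process;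
* ★ `isPosSemidefKernel_covariance` — covariance kernels of square-integrable processes are positive semidefinite (`Σ c c′ Cov = Var ≥ 0`).

## References

* O. Kallenberg, *Foundations of Modern Probability* (2002), Lemma 13.1. [Kallenberg2002]
* J. Glimm, A. Jaffe, *Quantum Physics* (2nd ed. 1987), §6.2. [GlimmJaffe1987]

Mathlib: `Matrix.PosSemidef.dotProduct_mulVec_nonneg ∕ of_dotProduct_mulVec_nonneg`, `Finset.sum_fiberwise_of_maps_to`, `IsGaussianProcess`
(`comp_right`, `hasGaussianLaw`), `HasGaussianLaw.map`, `covariance_fun_sum_fun_sum`, `covariance_self`, `variance_nonneg`.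
-/

noncomputable section

open MeasureTheory ProbabilityTheory Finset
open scoped BigOperators Matrix

namespace Literature.Probability.LatticeModels

open Literature.MathematicalPhysics.QuantumFieldTheory (IsPosSemidefKernel covGram covGram_apply gaussianFieldOfKernel
  isProbabilityMeasure_gaussianFieldOfKernel isGaussianProcess_eval_gaussianFieldOfKernel integral_eval_gaussianFieldOfKernel
  covariance_eval_gaussianFieldOfKernel eq_gaussianFieldOfKernel_of_isGaussianProcess)

/-! ## §1 Letters on positive-semidefinite kernels and Gaussian fields -/

section Kernels

variable {V : Type*}

/-- A positive-semidefinite kernel is symmetric. [cite: Kallenberg2002, Ch. 13 p.250 (covariance functions are symmetric nonnegative definite)] -/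
theorem isPosSemidefKernel_symm [DecidableEq V] {K : V → V → ℝ} (hK : IsPosSemidefKernel K) (a b : V) : K a b = K b a := by
  have h := (hK {a, b}).1
  have ha : a ∈ ({a, b} : Finset V) := by simp
  have hb : b ∈ ({a, b} : Finset V) := by simp
  have := congr_fun (congr_fun h ⟨b, hb⟩) ⟨a, ha⟩
  simpa [Matrix.conjTranspose_apply, covGram_apply] using this

/-- **The sum form of positive semidefiniteness** (families with repetitions allowed): `0 ≤ Σ_{i,j∈s} c_i c_j K(z_i, z_j)`.
(Group the coefficients along the fibres of `z`.) [cite: Kallenberg2002, Ch. 13 p.250 (nonnegative definite functions)] -/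
theorem isPosSemidefKernel_sum_sum_nonneg [DecidableEq V] {K : V → V → ℝ} (hK : IsPosSemidefKernel K) {ι : Type*} (s : Finset ι)
    (c : ι → ℝ) (z : ι → V) : 0 ≤ ∑ i ∈ s, ∑ j ∈ s, c i * c j * K (z i) (z j) := by
  classical
  set I : Finset V := s.image z with hI
  -- grouped coefficients
  set x : I → ℝ := fun v => ∑ i ∈ s with z i = (v : V), c i with hx
  have hpsd := (hK I).dotProduct_mulVec_nonneg x
  have hexp : star x ⬝ᵥ (covGram K I *ᵥ x) = ∑ v : I, ∑ w : I, x v * K v w * x w := by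
    simp only [star_trivial, dotProduct, Matrix.mulVec, covGram_apply, Finset.mul_sum]
    exact Finset.sum_congr rfl fun v _ => Finset.sum_congr rfl fun w _ => by ring
  rw [hexp] at hpsd
  -- ungroup: Σ_{v,w ∈ I} x_v K(v,w) x_w = Σ_{i,j ∈ s} c_i c_j K(z_i,z_j)
  have hmaps : ∀ i ∈ s, z i ∈ I := fun i hi => Finset.mem_image_of_mem z hi
  have key : ∑ v : I, ∑ w : I, x v * K v w * x w = ∑ i ∈ s, ∑ j ∈ s, c i * c j * K (z i) (z j) := by
    calc ∑ v : I, ∑ w : I, x v * K v w * x w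
        = ∑ v ∈ I, ∑ w ∈ I, (∑ i ∈ s with z i = v, c i) * K v w * ∑ j ∈ s with z j = w, c j := by
          rw [← Finset.sum_coe_sort I]
          refine Finset.sum_congr rfl fun v _ => ?_
          rw [← Finset.sum_coe_sort I]
      _ = ∑ v ∈ I, ∑ w ∈ I, ∑ i ∈ s with z i = v, ∑ j ∈ s with z j = w, c i * c j * K (z i) (z j) := by
          refine Finset.sum_congr rfl fun v _ => Finset.sum_congr rfl fun w _ => ?_
          rw [Finset.sum_mul, Finset.sum_mul]
          refine Finset.sum_congr rfl fun i hi => ?_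
          rw [Finset.mul_sum]
          refine Finset.sum_congr rfl fun j hj => ?_
          rw [(Finset.mem_filter.1 hi).2, (Finset.mem_filter.1 hj).2]
          ring
      _ = ∑ v ∈ I, ∑ i ∈ s with z i = v, ∑ w ∈ I, ∑ j ∈ s with z j = w, c i * c j * K (z i) (z j) := by
          refine Finset.sum_congr rfl fun v _ => ?_
          rw [Finset.sum_comm]
      _ = ∑ i ∈ s, ∑ w ∈ I, ∑ j ∈ s with z j = w, c i * c j * K (z i) (z j) := by
          rw [Finset.sum_fiberwise_of_maps_to hmaps]
      _ = ∑ i ∈ s, ∑ j ∈ s, c i * c j * K (z i) (z j) := by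
          refine Finset.sum_congr rfl fun i _ => ?_
          rw [Finset.sum_fiberwise_of_maps_to hmaps]
  rw [key] at hpsd
  exact hpsd

/-- **A symmetric kernel with the sum form of positivity is positive semidefinite.** [cite: Kallenberg2002, Ch. 13 p.250 (nonnegative definite functions)] -/
theorem isPosSemidefKernel_of_sum_sum_nonneg [DecidableEq V] {K : V → V → ℝ} (hsymm : ∀ a b, K a b = K b a)
    (hpos : ∀ (I : Finset V) (x : I → ℝ), 0 ≤ ∑ v : I, ∑ w : I, x v * x w * K v w) : IsPosSemidefKernel K := by
  intro I
  refine Matrix.PosSemidef.of_dotProduct_mulVec_nonneg ?_ fun x => ?_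
  · ext v w
    simp only [Matrix.conjTranspose_apply, covGram_apply, star_trivial]
    exact hsymm _ _
  · have hexp : star x ⬝ᵥ (covGram K I *ᵥ x) = ∑ v : I, ∑ w : I, x v * x w * K v w := by
      simp only [star_trivial, dotProduct, Matrix.mulVec, covGram_apply, Finset.mul_sum]
      exact Finset.sum_congr rfl fun v _ => Finset.sum_congr rfl fun w _ => by ring
    rw [hexp]
    exact hpos I x

/-- Re-indexing a positive-semidefinite kernel along any map of index sets keeps it positive semidefinite. [cite: Kallenberg2002, Ch. 13 p.250 (nonnegative definite functions)] -/
theorem isPosSemidefKernel_precomp [DecidableEq V] {J : Type*} [DecidableEq J] {K : V → V → ℝ} (hK : IsPosSemidefKernel K) (g : J → V) :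
    IsPosSemidefKernel fun j j' => K (g j) (g j') :=
  isPosSemidefKernel_of_sum_sum_nonneg (fun a b => isPosSemidefKernel_symm hK _ _) fun I x => by
    have := isPosSemidefKernel_sum_sum_nonneg hK (Finset.univ : Finset I) x (fun j => g (j : J))
    simpa using this

/-- **Push-forward of a Gaussian field under re-indexing of sites**: for any map `g : J → V`, `(N(0,K)).map (σ ↦ σ ∘ g) = N(0, K ∘ (g × g))`
(the pulled-back coordinate process is a centred Gaussian process with covariance `K(g j, g j′)`; uniqueness of the Gaussian field of
a kernel). [cite: Kallenberg2002, Lemma 13.1] -/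
theorem gaussianFieldOfKernel_map_precomp [DecidableEq V] {J : Type*} [DecidableEq J] {K : V → V → ℝ} (hK : IsPosSemidefKernel K)
    (g : J → V) :
    (gaussianFieldOfKernel K).map (fun (σ : V → ℝ) (j : J) => σ (g j)) = gaussianFieldOfKernel fun j j' => K (g j) (g j') := by
  haveI := isProbabilityMeasure_gaussianFieldOfKernel hK
  set T : (V → ℝ) → (J → ℝ) := fun σ j => σ (g j) with hT
  have hTm : Measurable T := measurable_pi_lambda _ fun j => measurable_pi_apply (g j)
  haveI : IsProbabilityMeasure ((gaussianFieldOfKernel K).map T) := Measure.isProbabilityMeasure_map hTm.aemeasurable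
  refine eq_gaussianFieldOfKernel_of_isGaussianProcess (isPosSemidefKernel_precomp hK g) ?_ (fun s => ?_) (fun s t => ?_)
  · have hX := (isGaussianProcess_eval_gaussianFieldOfKernel hK).comp_right g
    refine ⟨fun I => ⟨?_⟩⟩
    have hr : Measurable (fun ω : J → ℝ => I.restrict fun x => ω x) := Finset.measurable_restrict I
    rw [Measure.map_map hr hTm]
    have hfun : ((fun ω : J → ℝ => I.restrict fun x => ω x) ∘ T)
        = fun ω => I.restrict fun s => ((fun (s : V) (ω : V → ℝ) => ω s) ∘ g) s ω := by
      funext ω; rfl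
    rw [hfun]
    exact (hX.hasGaussianLaw I).isGaussian_map
  · rw [integral_map hTm.aemeasurable (measurable_pi_apply s).aestronglyMeasurable]
    exact integral_eval_gaussianFieldOfKernel hK (g s)
  · rw [covariance_map (measurable_pi_apply s).aestronglyMeasurable (measurable_pi_apply t).aestronglyMeasurable hTm.aemeasurable]
    exact covariance_eval_gaussianFieldOfKernel hK (g s) (g t)

/-- Over a FINITE index type the Gaussian field of a kernel is a Gaussian measure in Mathlib's sense (`IsGaussian` on the Banach space
`W → ℝ`). [cite: Kallenberg2002, Lemma 13.1] -/
theorem isGaussian_gaussianFieldOfKernel {W : Type*} [Fintype W] [DecidableEq W] {R : W → W → ℝ} (hR : IsPosSemidefKernel R) :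
    IsGaussian (gaussianFieldOfKernel R) := by
  have h := (isGaussianProcess_eval_gaussianFieldOfKernel hR).hasGaussianLaw Finset.univ
  let L : (↥(Finset.univ : Finset W) → ℝ) →L[ℝ] (W → ℝ) :=
    ContinuousLinearMap.pi fun w => ContinuousLinearMap.proj (R := ℝ) (φ := fun _ : ↥(Finset.univ : Finset W) => ℝ) ⟨w, Finset.mem_univ w⟩
  have h2 := h.map L
  have hid : (⇑L ∘ fun ω : W → ℝ => (Finset.univ : Finset W).restrict fun w => ω w) = id := by
    funext ω; rfl
  rw [hid] at h2
  have h3 := h2.isGaussian_map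
  rwa [Measure.map_id] at h3

/-- The coordinates of a GAUSSIAN RANDOM VECTOR `Y : Ω → ℝ^J` (`J` finite, Mathlib `HasGaussianLaw`) form a Gaussian process `j ↦ (Y ·) j`
(finite restrictions are continuous linear images). [cite: Kallenberg2002, Lemma 13.1] -/
theorem isGaussianProcess_apply_of_hasGaussianLaw {J Ω : Type*} [Fintype J] {mΩ : MeasurableSpace Ω} {P : Measure Ω} {Y : Ω → (J → ℝ)}
    (hY : HasGaussianLaw Y P) : IsGaussianProcess (fun (j : J) (ω : Ω) => Y ω j) P := by
  refine ⟨fun I => ?_⟩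
  let L : (J → ℝ) →L[ℝ] (↥I → ℝ) := ContinuousLinearMap.pi fun i : ↥I => ContinuousLinearMap.proj (R := ℝ) (φ := fun _ : J => ℝ) (i : J)
  have h : HasGaussianLaw (⇑L ∘ Y) P := hY.map L
  have hfun : (fun ω : Ω => I.restrict fun j => Y ω j) = ⇑L ∘ Y := by funext ω; rfl
  rw [hfun]
  exact h

/-- **Covariance kernels are positive semidefinite**: for a square-integrable real process `X` on a probability space,
`(j, j′) ↦ Cov(X_j, X_{j′})` is a positive-semidefinite kernel (`Σ c_i c_j Cov(X_i, X_j) = Var(Σ c_i X_i) ≥ 0`). [cite: Kallenberg2002, Ch. 13 p.250 (covariance functions are nonnegative definite)] -/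
theorem isPosSemidefKernel_covariance {J Ω : Type*} [DecidableEq J] {mΩ : MeasurableSpace Ω} {P : Measure Ω} [IsProbabilityMeasure P]
    {X : J → Ω → ℝ} (hX : ∀ j, MemLp (X j) 2 P) : IsPosSemidefKernel fun j j' => cov[X j, X j'; P] := by
  refine isPosSemidefKernel_of_sum_sum_nonneg (fun a b => covariance_comm _ _) fun I x => ?_
  have hYmem : MemLp (fun ω => ∑ v : ↥I, x v * X (↑v) ω) 2 P := memLp_finsetSum _ fun (v : ↥I) _ => (hX (↑v)).const_mul (x v)
  have h : cov[fun ω => ∑ v : ↥I, x v * X (↑v) ω, fun ω => ∑ w : ↥I, x w * X (↑w) ω; P] = ∑ v : ↥I, ∑ w : ↥I, x v * x w * cov[X ↑v, X ↑w; P] := by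
    rw [covariance_fun_sum_fun_sum (fun (v : ↥I) => (hX (↑v)).const_mul (x v)) (fun (w : ↥I) => (hX (↑w)).const_mul (x w))]
    refine Finset.sum_congr rfl fun v _ => Finset.sum_congr rfl fun w _ => ?_
    rw [covariance_const_mul_left, covariance_const_mul_right, mul_assoc]
  rw [← h, covariance_self hYmem.aemeasurable]
  exact variance_nonneg _ _

end Kernels

end Literature.Probability.LatticeModels
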